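import Mathlib
import Summits.ValiantsHypothesis.ValiantsHypothesis.Theses.FeketeSOS

/-!
# Sketch — crux-ideate (round 1, ideator 1) for crux `FeketeSOS.CharPSparseSOS` (stmt-ValiantsHypothesis-14989)

First lemmas (as `Prop`s, to be proved by a crux-plan / provers) for the two idea cards

* `interpolation-dual-redei`  : `InterpRootsSupport`, `InterpShift`, `InterpOrderDegree`, `InterpLogDeriv`,
                                  transfer target `RedeiForm` (equivalent to the crux by the four lemmas).
* `eulerian-core-twist`       : `feketeBar_eulerian`, `coreSquare`, `IotaSymmetrise`, `DicksonFekete`.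

Everything is stated over existing Mathlib declarations (`legendreSym`, `Polynomial.derivative`,
`Polynomial.comp`, `Polynomial.dickson`, `%ₘ`).
-/

set_option linter.dupNamespace false

open Polynomial Finset
open scoped BigOperators Classical

namespace Summit.ValiantsHypothesis.ValiantsHypothesis.Cruxes.CharPSparseSOS.Ideator1

noncomputable section

/-- The reduced Fekete polynomial `F̄_p = ∑_{m<p} (m|p) X^m` read in a ring `K`. -/
def feketeBar (K : Type) [Field K] (p : ℕ) [Fact p.Prime] : K[X] :=
  ∑ m ∈ range p, C ((legendreSym p m : ℤ) : K) * X ^ m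

/-- INTERPOLATION DUAL `W`: the coefficient function `m ↦ w.coeff m` of a polynomial of degree `< p`,
interpolated on `𝔽_p ⊂ K` by Lagrange indicators `1 - (θ - m)^{p-1}`.  (`θ` is the variable `X` of the
dual copy of `K[X]`.) -/
def interp (K : Type) [Field K] (p : ℕ) (w : K[X]) : K[X] :=
  ∑ m ∈ range p, C (w.coeff m) * (1 - (X - C (m : K)) ^ (p - 1))

/-- number of `𝔽_p`-rational roots of a polynomial `f ∈ K[θ]`. -/
def rootsFp (K : Type) [Field K] (p : ℕ) (f : K[X]) : ℕ :=
  ((range p).filter (fun e : ℕ => f.eval ((e : ℕ) : K) = 0)).card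

/-- truncated logarithm `z = log X = ∑_{1 ≤ k < p} (-1)^{k+1} (X-1)^k / k` (char `p`, `k < p` invertible). -/
def logX (K : Type) [Field K] (p : ℕ) : K[X] :=
  ∑ k ∈ Icc 1 (p - 1), C ((-1 : K) ^ (k + 1) / (k : K)) * (X - 1) ^ k

/-- (D1, provable now) sparsity = `p -` (number of `𝔽_p`-roots of the interpolation polynomial). -/
def InterpRootsSupport : Prop :=
  ∀ (K : Type) [Field K] (p : ℕ) [Fact p.Prime] [CharP K p] (w : K[X]), w.natDegree < p →
    rootsFp K p (interp K p w) + w.support.card = p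

/-- (D2, provable now) multiplication by `X^a` modulo `X^p - 1` is the shift `θ ↦ θ - a` on the dual side. -/
def InterpShift : Prop :=
  ∀ (K : Type) [Field K] (p : ℕ) [Fact p.Prime] [CharP K p] (w : K[X]) (a : ℕ), w.natDegree < p →
    interp K p ((X ^ a * w) %ₘ (X ^ p - 1)) = (interp K p w).comp (X - C (a : K))

/-- (D3, provable now) `(X-1)`-adic ORDER of `w` = `p - 1 -` DEGREE of its interpolation dual (char-`p` Hajós is
`degree ≥ number of roots` on the dual side). -/
def InterpOrderDegree : Prop :=
  ∀ (K : Type) [Field K] (p : ℕ) [Fact p.Prime] [CharP K p] (w : K[X]) (m : ℕ), w ≠ 0 → w.natDegree < p →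
    m < p → ((X - C 1) ^ m ∣ w ↔ (interp K p w).natDegree + m ≤ p - 1)

/-- (D4, provable now) multiplication by `z = log X` (mod `X^p - 1`) is `-d/dθ` on the dual side. -/
def InterpLogDeriv : Prop :=
  ∀ (K : Type) [Field K] (p : ℕ) [Fact p.Prime] [CharP K p], p ≠ 2 → ∀ (w : K[X]), w.natDegree < p →
    interp K p ((logX K p * w) %ₘ (X ^ p - 1)) = - derivative (interp K p w)

/-- (Transfer target C⁺ of card `interpolation-dual-redei`; EQUIVALENT to the crux by D1–D2 and bijectivity of
`interp` on `K[X]_{<p}`.)  RÉDEI FORM: the monomial `θ^{(p-1)/2}` (the dual of `F̄_p`, by Euler's criterion) is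
not a short sum `∑_i c_i ∑_{a ∈ 𝔽_p} f_i(a)·f_i(θ - a)` in which every `f_i ∈ K[θ]_{<p}` has at least
`p - t_i` roots in the PRIME FIELD and `∑ t_i < p^{1/2+δ}`. -/
def RedeiForm : Prop :=
  ∃ δ : ℝ, 0 < δ ∧ ∃ p₀ : ℕ, ∀ (p : ℕ) [Fact p.Prime], p₀ ≤ p → ∀ (K : Type) [Field K] [CharP K p]
    (s : ℕ) (c : Fin s → K) (f : Fin s → K[X]), (s : ℝ) ≤ (p : ℝ) ^ δ → (∀ i, (f i).natDegree < p) →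
    (X : K[X]) ^ ((p - 1) / 2) =
      ∑ i, C (c i) * ∑ a ∈ range p, C ((f i).eval (a : K)) * (f i).comp (X - C (a : K)) →
    (p : ℝ) ^ (1 / 2 + δ) ≤ ∑ i, ((p : ℝ) - (rootsFp K p (f i) : ℝ))

/-! ### card `eulerian-core-twist` -/

/-- Eulerian numbers `A(n,k) = ∑_{j ≤ k} (-1)^j C(n+1,j) (k+1-j)^n`. -/
def eulerianNum (n k : ℕ) : ℤ :=
  ∑ j ∈ range (k + 1), (-1 : ℤ) ^ j * (Nat.choose (n + 1) j : ℤ) * (((k + 1 - j : ℕ) : ℤ)) ^ n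

/-- Eulerian polynomial `A_n(X) = ∑_{k<n} A(n,k) X^k` (so `∑_m m^n X^m = X A_n(X)/(1-X)^{n+1}`). -/
def eulerianPoly (n : ℕ) : ℤ[X] := ∑ k ∈ range n, C (eulerianNum n k) * X ^ k

/-- (E1, provable now; MNT Prop 5.1 sharpened to an identity) EULERIAN NORMAL FORM: in characteristic `p ≠ 2`,
`F̄_p = X · A_N(X) · (1 - X)^N` EXACTLY in `K[X]`, `N = (p-1)/2`.  The cheap CORE is `X^N (1-X)^N`
(one sparse square, `coreSquare`); the palindromic unit `X^{1-N} A_N(X) ∈ K[X + X⁻¹]` is the TWIST. -/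
def feketeBar_eulerian : Prop :=
  ∀ (K : Type) [Field K] (p : ℕ) [Fact p.Prime] [CharP K p], p ≠ 2 →
    feketeBar K p = X * (eulerianPoly ((p - 1) / 2)).map (Int.castRingHom K) * (1 - X) ^ ((p - 1) / 2)

/-- (E2, provable now) the core `X^N(1-X)^N`, of exact `(X-1)`-order `N`, is ONE square of the `(N/2+1)`-nomial
`(X - X²)^{N/2}`: support-sum `(p+3)/4` — the constant of `CharPSOSOrderDichotomy` and of the conjectured
linear form of the crux is attained by the core. -/
def coreSquare : Prop :=
  ∀ (K : Type) [Field K] (p : ℕ) [Fact p.Prime] [CharP K p] (n : ℕ), 2 * n < p →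
    (((X : K[X]) - X ^ 2) ^ n).support.card = n + 1 ∧
    (((X : K[X]) - X ^ 2) ^ n) ^ 2 = X ^ (2 * n) * (1 - X) ^ (2 * n)

/-- the involution `ι : X^m ↦ X^{-m}` on `K[X]_{<p}` (exponents mod `p`). -/
def iota (K : Type) [Field K] (p : ℕ) (g : K[X]) : K[X] :=
  ∑ m ∈ range p, C (g.coeff m) * X ^ ((p - m) % p)

/-- (E3, provable now) ι-SYMMETRISATION: a cyclic representation of an ι-invariant target can be replaced by
one whose squares are ι-eigenvectors (palindromic / antipalindromic), at cost `× 2` in `s` and in support. -/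
def IotaSymmetrise : Prop :=
  ∀ (K : Type) [Field K] (p : ℕ) [Fact p.Prime] [CharP K p], p ≠ 2 →
    ∀ (F : K[X]) (s : ℕ) (c : Fin s → K) (g : Fin s → K[X]),
    F.natDegree < p → iota K p F = F → (∀ i, (g i).natDegree < p) →
    ((X : K[X]) ^ p - 1 ∣ (∑ i, C (c i) * g i ^ 2) - F) →
    ∃ (c' : Fin (2 * s) → K) (g' : Fin (2 * s) → K[X]),
      (∀ j, (g' j).natDegree < p) ∧ (∀ j, iota K p (g' j) = g' j ∨ iota K p (g' j) = - g' j) ∧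
      (∑ j, (g' j).support.card) ≤ 2 * ∑ i, (g i).support.card ∧
      ((X : K[X]) ^ p - 1 ∣ (∑ j, C (c' j) * g' j ^ 2) - F)

/-- (E4, provable now) DICKSON–FEKETE factorisation in the Chebyshev algebra `K[u]`, `u = X + X⁻¹`
(`p ≡ 1 mod 4`, `N = (p-1)/2` even): `∑_{1 ≤ m ≤ N} (m|p)·D_m(u) = (u - 2)^{N/2} · E(u)` with `E(2) ≠ 0`
— an HONEST polynomial identity of degree `N` (no truncation), the image of `F̄_p = ∑_{m ≤ N} χ(m)(X^m + X^{-m})`. -/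
def DicksonFekete : Prop :=
  ∀ (K : Type) [Field K] (p : ℕ) [Fact p.Prime] [CharP K p], p % 4 = 1 →
    ∃ E : K[X], E.eval 2 ≠ 0 ∧
      (∑ m ∈ Icc 1 ((p - 1) / 2), C ((legendreSym p m : ℤ) : K) * Polynomial.dickson 1 (1 : K) m)
        = (X - C 2) ^ ((p - 1) / 4) * E

/-- the crux, for reference (audit: the cards' transfer targets imply / are equivalent to THIS decl). -/
example : Prop := Summit.ValiantsHypothesis.ValiantsHypothesis.Theses.FeketeSOS.CharPSparseSOS

end

end Summit.ValiantsHypothesis.ValiantsHypothesis.Cruxes.CharPSparseSOS.Ideator1
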